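import Summits.BirchSwinnertonDyer.BirchSwinnertonDyer.Theorems.KolyvaginRoadThreeZhangSupplyTransverseCount
import Summits.BirchSwinnertonDyer.BirchSwinnertonDyer.Theorems.KolyvaginRoadThreeZhangSupplyIsoBoundCases
import Summits.BirchSwinnertonDyer.BirchSwinnertonDyer.Theorems.KolyvaginRoadThreeZhangSupplySignedAssembled
import Summits.BirchSwinnertonDyer.BirchSwinnertonDyer.Theorems.KolyvaginRoadThreeMethod2TriangulationOfKolyvaginLocal
import HarnessLib

/-!
# Route `KolyvaginRoadThree`, deciding crux `ZhangSharpFrameAtThreeHL` (item stmt-BirchSwinnertonDyer-19574):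
# S2-ENGINE's (Supply) binder `hSupply` FROM THE POITOU–TATE FACT, modulo the both-ramified line-rigidity at λ
# (cell `bsd-stepL`, ACCEL seat `bsd-stepL-koly3b` g6; `--supports stmt-BirchSwinnertonDyer-19574`, helper; part XXV of the
# `KolyvaginRoadThreeZhangSupply*` series — the ASSEMBLY)

HONEST FRAMING. Theorems only; 0 definitions, 0 named facts, 0 `sorry`; CONDITIONAL on the named PT fact
`poitouTate_selmerStructure_duality K` and on ONE local input at Kolyvagin primes (below); closes nothing (T7). PARTITION:
O2@3 (B10) × A1 × crux 19574 × the S2-ENGINE's (Supply) binder — proves-glue (assembly).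

WHAT. `hSupply_of_poitouTate`: the binder `hSupply` of `Method2.triangulation_of_kolyvaginLocal` (p508963) ∕ of
`Method2.triangulation_of_supply` — for every good non-empty level — from the frame (`K` imaginary quadratic, `d_K < −4`,
`c ≠ 1`), the PT fact, the places `plK`, and `hboundCup` = the local line-rigidity at Kolyvagin primes in cup-product
currency. Assembly = part XIII `supply_signed_of_jump_bound` ∘ (p508963 §1 apparatus: genuine `loc`, `b_v = inv_v ∘ ∪ₑ` for
the PERFECT PT family of the totally complex `K` (tree THEOREM), (REC), Kummer ∕ ordinary ∕ transverse isotropy — all tree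
theorems) ∘ `hjump_of_poitouTate` (part XXII) ∘ (`hbound` from `hboundCup` by injectivity of `inv_λ`).
`hSupply_of_poitouTate_of_ramifiedCase`: the same with `hboundCup` replaced, via part XXIV
(`sub_zsmul_mem_torsionLocalKer_of_isotropic_of_ramifiedCase`: the Selmer cases are zhang3-p1 g9's landed theorems), by
the BOTH-RAMIFIED case `hram` only — the last named input of S2-ENGINE's (Supply) (zhang3-p1 g9 (b1)+(b2)).

References: [cite: WZhang2014, Lemma 8.2, Lemma 8.4] [cite: McCallumLMS1991, Prop. 2.1, Lemma 5.3] [cite: MilneADT2006, Ch. I,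
Cor. 2.3, Thm. 4.10] [cite: GrossLMS1991, Prop. 8.1–8.2].
-/

noncomputable section

open scoped Classical Pointwise

universe u

namespace Summit.BirchSwinnertonDyer.Rank1Residual.X11b.Three.Koly.ZhangSupply

open CategoryTheory WeierstrassCurve Field Function NumberField IsDedekindDomain
open Literature.NumberTheory.EllipticCurves Literature.NumberTheory.EllipticCurves.ModularForms
  Literature.NumberTheory.GaloisRepresentations Module
open Literature.NumberTheory.GaloisRepresentations.DiscreteGaloisModule (mu MuCarrier)
open Literature.NumberTheory.GaloisCohomology
open Summit.BirchSwinnertonDyer.Rank1Residual.X11b.Three.Koly.Method2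
open Summit.BirchSwinnertonDyer.Rank1Residual.X11b.Three.Koly.Method2.KolyLocal
open Summit.BirchSwinnertonDyer.Rank1Residual.GaloisImage
open scoped ContRepresentation

-- Cup products need `LocallyCompactSpace Γ`; `E[n]` finite: local instances (as in the tree's cup-product files).
attribute [local instance] absoluteGaloisGroup_compactSpace
attribute [local instance] finite_geomTorsion_of_neZero

variable (W : WeierstrassCurve ℚ) (K : Type) [Field K] [NumberField K] [W.IsElliptic] [W.IsGloballyMinimal]

/-! ## §6 `hSupply` from the Poitou–Tate fact and (IsoBound) in cup-product currency -/

/-- **S2-ENGINE's (Supply) binder `hSupply` from the Poitou–Tate fact, modulo (IsoBound) in cup-product currency.**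
The binder `hSupply` of `Method2.triangulation_of_kolyvaginLocal` (p508963) — for every good non-empty level — follows from
the frame (`K` imaginary quadratic, `d_K < −4`, complex conjugation `c ≠ 1`), the named PT fact, and ONE local input
`hboundCup`: at every Kolyvagin `λ`, for every Weil-type pairing, two `c`-eigenclasses of the same sign whose localisations
are mutually and self isotropic for the local Weil cup product, the first with `loc_λ ≠ 0`, have proportional localisations.
Assembly: part XIII `supply_signed_of_jump_bound` with the apparatus of p508963 §1 (`loc` = genuine localisation, `b_v =
inv_v ∘ ∪ₑ` for the PERFECT Poitou–Tate family of the totally complex `K` — tree THEOREM; (REC), Kummer ∕ ordinary ∕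
transverse isotropy all tree theorems), `hjump := hjump_of_poitouTate` (§5), and `hbound` from `hboundCup` by the
injectivity of `inv_λ`. [cite: WZhang2014, Lemma 8.2] [cite: McCallumLMS1991, Prop. 2.1] [cite: MilneADT2006, Ch. I,
Cor. 2.3, Thm. 4.10] -/
theorem hSupply_of_poitouTate [Module (ZMod 3) (V3 W K)] (ι : K →+* ℂ) (c : K ≃ₐ[ℚ] K)
    (hK : IsImaginaryQuadratic K) (hd : NumberField.discr K < -4) (hc : c ≠ 1)
    (hPT : poitouTate_selmerStructure_duality K)
    (plK : {ℓ // Zhang2014.IsKolyvaginPrime (W.conductorNorm ℤ) W K 3 ℓ} → HeightOneSpectrum (𝓞 K))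
    (hplK : ∀ ℓ, ((ℓ : ℕ) : 𝓞 K) ∈ (plK ℓ).asIdeal)
    (hboundCup : ∀ (e : geomTorsion (W.baseChange K) ((3 ^ 1 : ℕ) : ℤ) → geomTorsion (W.baseChange K) ((3 ^ 1 : ℕ) : ℤ) →
          AlgebraicClosure K)
        (hμ : ∀ P Q, e P Q ^ (3 ^ 1) = 1) (hadd₁ : ∀ P₁ P₂ Q, e (P₁ + P₂) Q = e P₁ Q * e P₂ Q)
        (hadd₂ : ∀ P Q₁ Q₂, e P (Q₁ + Q₂) = e P Q₁ * e P Q₂) (_halt : ∀ Q, e Q Q = 1)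
        (_hnondeg : ∀ Q, (∀ P, e P Q = 1) → Q = 0)
        (hgal : ∀ (σ : absoluteGaloisGroup K) (P Q : geomTorsion (W.baseChange K) ((3 ^ 1 : ℕ) : ℤ)),
          σ • e P Q = e (σ • P) (σ • Q))
        (ℓ : {ℓ // Zhang2014.IsKolyvaginPrime (W.conductorNorm ℤ) W K 3 ℓ}) (s : Bool) (x y : V3 W K),
      conjAct W c ((3 ^ 1 : ℕ) : ℤ) x = sgn s • x → conjAct W c ((3 ^ 1 : ℕ) : ℤ) y = sgn s • y →
      (weilContPairingLocal (W.baseChange K) (3 ^ 1) e hμ hadd₁ hadd₂ hgal (Sum.inr (plK ℓ))).cupProduct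
        (galoisCohomology.localization ((W.baseChange K).torsionGaloisModule ((3 ^ 1 : ℕ) : ℤ)) (Sum.inr (plK ℓ)) 1 x)
        (galoisCohomology.localization ((W.baseChange K).torsionGaloisModule ((3 ^ 1 : ℕ) : ℤ)) (Sum.inr (plK ℓ)) 1 x)
          = 0 →
      (weilContPairingLocal (W.baseChange K) (3 ^ 1) e hμ hadd₁ hadd₂ hgal (Sum.inr (plK ℓ))).cupProduct
        (galoisCohomology.localization ((W.baseChange K).torsionGaloisModule ((3 ^ 1 : ℕ) : ℤ)) (Sum.inr (plK ℓ)) 1 x)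
        (galoisCohomology.localization ((W.baseChange K).torsionGaloisModule ((3 ^ 1 : ℕ) : ℤ)) (Sum.inr (plK ℓ)) 1 y)
          = 0 →
      (weilContPairingLocal (W.baseChange K) (3 ^ 1) e hμ hadd₁ hadd₂ hgal (Sum.inr (plK ℓ))).cupProduct
        (galoisCohomology.localization ((W.baseChange K).torsionGaloisModule ((3 ^ 1 : ℕ) : ℤ)) (Sum.inr (plK ℓ)) 1 y)
        (galoisCohomology.localization ((W.baseChange K).torsionGaloisModule ((3 ^ 1 : ℕ) : ℤ)) (Sum.inr (plK ℓ)) 1 x)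
          = 0 →
      (weilContPairingLocal (W.baseChange K) (3 ^ 1) e hμ hadd₁ hadd₂ hgal (Sum.inr (plK ℓ))).cupProduct
        (galoisCohomology.localization ((W.baseChange K).torsionGaloisModule ((3 ^ 1 : ℕ) : ℤ)) (Sum.inr (plK ℓ)) 1 y)
        (galoisCohomology.localization ((W.baseChange K).torsionGaloisModule ((3 ^ 1 : ℕ) : ℤ)) (Sum.inr (plK ℓ)) 1 y)
          = 0 →
      x ∉ (W.baseChange K).torsionLocalKer ((plK ℓ).adicCompletion K) ((3 ^ 1 : ℕ) : ℤ) →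
      ∃ a : ℤ, y - a • x ∈ (W.baseChange K).torsionLocalKer ((plK ℓ).adicCompletion K) ((3 ^ 1 : ℕ) : ℤ)) :
    ∀ (n : Finset {q // IsUAdmissiblePrime W K q}), GoodLevel W K n → n.Nonempty →
      ∀ (ℓ : {ℓ // Zhang2014.IsKolyvaginPrime (W.conductorNorm ℤ) W K 3 ℓ}) (T : Finset _), ℓ ∉ T →
      ∀ s : Bool, ∃ x : V3 W K, conjAct W c ((3 ^ 1 : ℕ) : ℤ) x = sgn s • x ∧ x ≠ 0 ∧
        (∀ w : InfinitePlace K, x ∈ selmerLocalKer (W.baseChange K) w.Completion ((3 ^ 1 : ℕ) : ℤ)) ∧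
        (∀ v : HeightOneSpectrum (𝓞 K), v ≠ plK ℓ → (∀ ℓ' ∈ T, plK ℓ' ≠ v) →
          ((∀ q ∈ n, ((q : ℕ) : 𝓞 K) ∉ v.asIdeal) →
            x ∈ selmerLocalKer (W.baseChange K) (v.adicCompletion K) ((3 ^ 1 : ℕ) : ℤ)) ∧
          (∀ q ∈ n, ((q : ℕ) : 𝓞 K) ∈ v.asIdeal →
            x ∈ (W.baseChange K).ordinaryLocalKer (v.adicCompletion K) ((3 ^ 1 : ℕ) : ℤ))) ∧
        (∀ ℓ' ∈ T, x ∈ transverseLocalKer W K ι ℓ' (plK ℓ')) := by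
  haveI : IsTotallyComplex K := hK.2
  haveI : Fact (Nat.Prime (3 ^ 1)) := ⟨by norm_num⟩
  haveI : NeZero (3 ^ 1 : ℕ) := ⟨by norm_num⟩
  -- the `ZMod 3`-structure of the local cohomology groups
  have hV3 : ∀ (v : Place K) (x : galoisCohomology (((W.baseChange K).torsionGaloisModule ((3 ^ 1 : ℕ) :
      ℤ)).toLocal v) 1), 3 • x = 0 := fun v x ↦
    galoisCohomology.nsmul_eq_zero_of_forall (((W.baseChange K).torsionGaloisModule ((3 ^ 1 : ℕ) : ℤ)).toLocal v)
      (n := 3 ^ 1) (fun m => AddSubgroup.torsionBy.nsmul m) x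
  letI : ∀ v : Place K, Module (ZMod 3) (galoisCohomology (((W.baseChange K).torsionGaloisModule ((3 ^ 1 : ℕ) :
      ℤ)).toLocal v) 1) := fun v ↦ AddCommGroup.zmodModule (hV3 v)
  -- the localisations, a Weil pairing, the Poitou–Tate family, the local forms
  obtain ⟨loc, hloc⟩ := exists_zmodLinear_localization W K
  obtain ⟨e, hμ, hadd₁, hadd₂, halt, hnondeg, hgal⟩ :=
    exists_weilPairing_holds (W.baseChange K) (3 ^ 1) (by norm_num) (by norm_num)
  obtain ⟨inv, hinvperf, hPTsum⟩ := poitouTate_sum_localTatePairing_eq_zero_of_isTotallyComplex K (3 ^ 1)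
  obtain ⟨b, hb⟩ := exists_zmodBilinear_invCupProduct W K e hμ hadd₁ hadd₂ hgal inv
  have hrec : ∀ (x y : V3 W K) (T : Finset (Place K)), (∀ v, v ∉ T → b v (loc v x) (loc v y) = 0) →
      ∑ v ∈ T, b v (loc v x) (loc v y) = 0 := fun x y T hT ↦ sum_invCupProduct_eq_zero W K hb hloc hPTsum x y T hT
  have hisoKum := fun v ↦ invCupProduct_eq_zero_of_mem_kummer W K hb halt v
  have hisoOrd : ∀ (q : {q // IsUAdmissiblePrime W K q}), FrobSqNeOneAt W 3 q.1 →
      ∀ (v : HeightOneSpectrum (𝓞 K)), ((q : ℕ) : 𝓞 K) ∈ v.asIdeal → ∀ (x y : V3 W K),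
      x ∈ (W.baseChange K).ordinaryLocalKer (v.adicCompletion K) ((3 ^ 1 : ℕ) : ℤ) →
      y ∈ (W.baseChange K).ordinaryLocalKer (v.adicCompletion K) ((3 ^ 1 : ℕ) : ℤ) →
      b (Sum.inr v) (loc (Sum.inr v) x) (loc (Sum.inr v) y) = 0 :=
    fun q hq v hqv x y hx hy ↦ invCupProduct_eq_zero_of_mem_ordinary W K hb hloc hK halt q hq v hqv x y hx hy
  have hinj : ∀ v : HeightOneSpectrum (𝓞 K), Injective (inv (Sum.inr v)) := fun v ↦ (hinvperf v).1.1
  have hisoTr : ∀ (ℓ : {ℓ // Zhang2014.IsKolyvaginPrime (W.conductorNorm ℤ) W K 3 ℓ}) (x y : V3 W K),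
      x ∈ transverseLocalKer W K ι ℓ (plK ℓ) → y ∈ transverseLocalKer W K ι ℓ (plK ℓ) →
      b (Sum.inr (plK ℓ)) (loc (Sum.inr (plK ℓ)) x) (loc (Sum.inr (plK ℓ)) y) = 0 := by
    intro ℓ x y hx hy
    rw [hb, hloc, hloc, KolyLocal.cupProduct_eq_zero_of_mem_transverseLocalKer W K hK ι e hμ hadd₁ hadd₂ hgal ℓ.2
      (plK ℓ) (hplK ℓ) hx hy]
    exact map_zero _
  have hjump := hjump_of_poitouTate W K hK hd hPT ι plK hplK
  -- (IsoBound) in `b`-currency from the cup-product currency (`inv_λ` is injective)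
  have hcup0 : ∀ (ℓ : {ℓ // Zhang2014.IsKolyvaginPrime (W.conductorNorm ℤ) W K 3 ℓ}) (x y : V3 W K),
      b (Sum.inr (plK ℓ)) (loc (Sum.inr (plK ℓ)) x) (loc (Sum.inr (plK ℓ)) y) = 0 →
      (weilContPairingLocal (W.baseChange K) (3 ^ 1) e hμ hadd₁ hadd₂ hgal (Sum.inr (plK ℓ))).cupProduct
        (galoisCohomology.localization ((W.baseChange K).torsionGaloisModule ((3 ^ 1 : ℕ) : ℤ)) (Sum.inr (plK ℓ)) 1 x)
        (galoisCohomology.localization ((W.baseChange K).torsionGaloisModule ((3 ^ 1 : ℕ) : ℤ)) (Sum.inr (plK ℓ)) 1 y)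
          = 0 := by
    intro ℓ x y h
    rw [hb, hloc, hloc] at h
    exact hinj _ (h.trans (map_zero _).symm)
  have hbound : ∀ (ℓ : {ℓ // Zhang2014.IsKolyvaginPrime (W.conductorNorm ℤ) W K 3 ℓ}) (s : Bool) (x y : V3 W K),
      conjAct W c ((3 ^ 1 : ℕ) : ℤ) x = sgn s • x → conjAct W c ((3 ^ 1 : ℕ) : ℤ) y = sgn s • y →
      b (Sum.inr (plK ℓ)) (loc (Sum.inr (plK ℓ)) x) (loc (Sum.inr (plK ℓ)) x) = 0 →
      b (Sum.inr (plK ℓ)) (loc (Sum.inr (plK ℓ)) x) (loc (Sum.inr (plK ℓ)) y) = 0 →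
      b (Sum.inr (plK ℓ)) (loc (Sum.inr (plK ℓ)) y) (loc (Sum.inr (plK ℓ)) x) = 0 →
      b (Sum.inr (plK ℓ)) (loc (Sum.inr (plK ℓ)) y) (loc (Sum.inr (plK ℓ)) y) = 0 →
      x ∉ (W.baseChange K).torsionLocalKer ((plK ℓ).adicCompletion K) ((3 ^ 1 : ℕ) : ℤ) →
      ∃ a : ℤ, y - a • x ∈ (W.baseChange K).torsionLocalKer ((plK ℓ).adicCompletion K) ((3 ^ 1 : ℕ) : ℤ) :=
    fun ℓ s x y hxs hys h11 h12 h21 h22 hx0 ↦ hboundCup e hμ hadd₁ hadd₂ halt hnondeg hgal ℓ s x y hxs hys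
      (hcup0 ℓ x x h11) (hcup0 ℓ x y h12) (hcup0 ℓ y x h21) (hcup0 ℓ y y h22) hx0
  exact supply_signed_of_jump_bound W K ι c hK hc loc hloc plK hplK b hrec hisoKum hisoOrd hisoTr hjump hbound


/-! ## §7 `hSupply` modulo the both-ramified case only -/

/-- **`hSupply` from the Poitou–Tate fact, modulo the BOTH-RAMIFIED line-rigidity only.** As `hSupply_of_poitouTate`, with
`hboundCup` supplied by part XXIV from the two Selmer cases (zhang3-p1 g9, landed) and the hypothesis `hram`: at every
Kolyvagin `λ = plK ℓ`, for every Weil-type `e` and sign `s`, two `c`-eigenclasses of sign `s` BOTH RAMIFIED at `λ` (not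
Selmer) with `x∪x = x∪y = y∪y = 0` and `loc_λ x ≠ 0` have proportional localisations. [cite: WZhang2014, Lemma 8.2, 8.4]
[cite: GrossLMS1991, Prop. 8.1–8.2] -/
theorem hSupply_of_poitouTate_of_ramifiedCase [Module (ZMod 3) (V3 W K)] (ι : K →+* ℂ) (c : K ≃ₐ[ℚ] K)
    (hK : IsImaginaryQuadratic K) (hd : NumberField.discr K < -4) (hc : c ≠ 1)
    (hsurj : W.HasSurjectiveModNGaloisRep 3) (hPT : poitouTate_selmerStructure_duality K)
    (plK : {ℓ // Zhang2014.IsKolyvaginPrime (W.conductorNorm ℤ) W K 3 ℓ} → HeightOneSpectrum (𝓞 K))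
    (hplK : ∀ ℓ, ((ℓ : ℕ) : 𝓞 K) ∈ (plK ℓ).asIdeal)
    (hram : ∀ (e : geomTorsion (W.baseChange K) ((3 ^ 1 : ℕ) : ℤ) → geomTorsion (W.baseChange K) ((3 ^ 1 : ℕ) : ℤ) →
          AlgebraicClosure K)
        (hμ : ∀ P Q, e P Q ^ (3 ^ 1) = 1) (hadd₁ : ∀ P₁ P₂ Q, e (P₁ + P₂) Q = e P₁ Q * e P₂ Q)
        (hadd₂ : ∀ P Q₁ Q₂, e P (Q₁ + Q₂) = e P Q₁ * e P Q₂) (_halt : ∀ Q, e Q Q = 1)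
        (_hnondeg : ∀ Q, (∀ P, e P Q = 1) → Q = 0)
        (hgal : ∀ (σ : absoluteGaloisGroup K) (P Q : geomTorsion (W.baseChange K) ((3 ^ 1 : ℕ) : ℤ)),
          σ • e P Q = e (σ • P) (σ • Q))
        (ℓ : {ℓ // Zhang2014.IsKolyvaginPrime (W.conductorNorm ℤ) W K 3 ℓ}) (s : Bool) (x y : V3 W K),
      conjAct W c ((3 ^ 1 : ℕ) : ℤ) x = sgn s • x → conjAct W c ((3 ^ 1 : ℕ) : ℤ) y = sgn s • y →
      x ∉ selmerLocalKer (W.baseChange K) ((plK ℓ).adicCompletion K) ((3 ^ 1 : ℕ) : ℤ) →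
      y ∉ selmerLocalKer (W.baseChange K) ((plK ℓ).adicCompletion K) ((3 ^ 1 : ℕ) : ℤ) →
      (weilContPairingLocal (W.baseChange K) (3 ^ 1) e hμ hadd₁ hadd₂ hgal (Sum.inr (plK ℓ))).cupProduct
        (galoisCohomology.localization ((W.baseChange K).torsionGaloisModule ((3 ^ 1 : ℕ) : ℤ)) (Sum.inr (plK ℓ)) 1 x)
        (galoisCohomology.localization ((W.baseChange K).torsionGaloisModule ((3 ^ 1 : ℕ) : ℤ)) (Sum.inr (plK ℓ)) 1 x)
          = 0 →
      (weilContPairingLocal (W.baseChange K) (3 ^ 1) e hμ hadd₁ hadd₂ hgal (Sum.inr (plK ℓ))).cupProduct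
        (galoisCohomology.localization ((W.baseChange K).torsionGaloisModule ((3 ^ 1 : ℕ) : ℤ)) (Sum.inr (plK ℓ)) 1 x)
        (galoisCohomology.localization ((W.baseChange K).torsionGaloisModule ((3 ^ 1 : ℕ) : ℤ)) (Sum.inr (plK ℓ)) 1 y)
          = 0 →
      (weilContPairingLocal (W.baseChange K) (3 ^ 1) e hμ hadd₁ hadd₂ hgal (Sum.inr (plK ℓ))).cupProduct
        (galoisCohomology.localization ((W.baseChange K).torsionGaloisModule ((3 ^ 1 : ℕ) : ℤ)) (Sum.inr (plK ℓ)) 1 y)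
        (galoisCohomology.localization ((W.baseChange K).torsionGaloisModule ((3 ^ 1 : ℕ) : ℤ)) (Sum.inr (plK ℓ)) 1 y)
          = 0 →
      x ∉ (W.baseChange K).torsionLocalKer ((plK ℓ).adicCompletion K) ((3 ^ 1 : ℕ) : ℤ) →
      ∃ a : ℤ, y - a • x ∈ (W.baseChange K).torsionLocalKer ((plK ℓ).adicCompletion K) ((3 ^ 1 : ℕ) : ℤ)) :
    ∀ (n : Finset {q // IsUAdmissiblePrime W K q}), GoodLevel W K n → n.Nonempty →
      ∀ (ℓ : {ℓ // Zhang2014.IsKolyvaginPrime (W.conductorNorm ℤ) W K 3 ℓ}) (T : Finset _), ℓ ∉ T →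
      ∀ s : Bool, ∃ x : V3 W K, conjAct W c ((3 ^ 1 : ℕ) : ℤ) x = sgn s • x ∧ x ≠ 0 ∧
        (∀ w : InfinitePlace K, x ∈ selmerLocalKer (W.baseChange K) w.Completion ((3 ^ 1 : ℕ) : ℤ)) ∧
        (∀ v : HeightOneSpectrum (𝓞 K), v ≠ plK ℓ → (∀ ℓ' ∈ T, plK ℓ' ≠ v) →
          ((∀ q ∈ n, ((q : ℕ) : 𝓞 K) ∉ v.asIdeal) →
            x ∈ selmerLocalKer (W.baseChange K) (v.adicCompletion K) ((3 ^ 1 : ℕ) : ℤ)) ∧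
          (∀ q ∈ n, ((q : ℕ) : 𝓞 K) ∈ v.asIdeal →
            x ∈ (W.baseChange K).ordinaryLocalKer (v.adicCompletion K) ((3 ^ 1 : ℕ) : ℤ))) ∧
        (∀ ℓ' ∈ T, x ∈ transverseLocalKer W K ι ℓ' (plK ℓ')) :=
  hSupply_of_poitouTate W K ι c hK hd hc hPT plK hplK fun e hμ hadd₁ hadd₂ halt hnondeg hgal ℓ s _ _ hxs hys h11 h12 h21 h22 hx0 ↦
    sub_zsmul_mem_torsionLocalKer_of_isotropic_of_ramifiedCase W K hK hsurj hc e hμ hadd₁ hadd₂ halt hnondeg hgal ℓ.2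
      (plK ℓ) (hplK ℓ) s (hram e hμ hadd₁ hadd₂ halt hnondeg hgal ℓ s) hxs hys h11 h12 h21 h22 hx0

end Summit.BirchSwinnertonDyer.Rank1Residual.X11b.Three.Koly.ZhangSupply

end
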